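import Summits.CriticalPhenomena.Ising3D.TaylorRegionTableRows
import Summits.CriticalPhenomena.Ising3D.TaylorRegionCertsH
import Mathlib.Tactic.Linarith
import Mathlib.Tactic.Positivity
import Mathlib.Tactic.Ring
import HarnessLib

/-!
# Hybrid region checks with the per-`j` rows taken from the `(P, D)` table (kernel-cost repair, part 2: the checks)
(cell `pub-ising3x`, seat recog-1 gen 11; gate (g2) — same statements as `TaylorRegionCheckHybrid(L)`, cheaper rows)

HONEST FRAMING: lottery ticket; floor = tightest certified 3D Ising CFT bounds; no exact-solution
claim without a proof. Island framing: certified exclusion region at stated derivative order and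
assumptions; not a determination of the 3D Ising critical exponents beyond that.

`EvenRegionDataH.checkP` / `OddConeRegionDataH.checkP`: the hybrid checks with the bounded-part rows built from the
`(P, D)` tables (`qRowOfTableI`, `O(N·Λ)` interval operations per row instead of the `q`-sum list algorithm's
`O(j·|l|·Λ²)`), positivity in `P = E − cc` (`rowPosP`), the even discriminant rows by the product-free enclosure
test (`rowPosDE`), tails as in `checkL` / `check`. **`taylorEvenRegion_of_evenRegionCheckHP`** and
**`oddCone_of_oddConeRegionCheckHP`** have the statements of the `H` theorems. MEASURED kernel costs that forced
this (vanilla `Λ = 11` functional, scale `2^64`, `decide +kernel` on the farm): `q`-sum row `j = 41` > 1 292 s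
unfinished vs table row `j = 41` incl. `posOn` ≈ 15 s; one local-PRODUCT discriminant piece ≈ 70 s vs three
enclosures < 1 s. Elementary. [folklore]
-/

namespace Summit.CriticalPhenomena.Ising3D

open Finset Set
open Literature.Analysis.ValidatedNumerics Literature.Analysis.ValidatedNumerics.PolyMP
open Literature.Analysis.ValidatedNumerics.NumericsMP (MI)
open Literature.MathematicalPhysics.QuantumFieldTheory.ConformalBootstrap3D

/-! ### Even sector -/

namespace EvenRegionDataH

/-- `(P,D)` tables of the four components. [folklore] -/
def QX (d : EvenRegionDataH) : IPoly2 := kernelPDLI d.S (d.cQ 0) (-1) (signedChooseI d.S d.sσI) d.ccQ d.l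
/-- [folklore] -/
def QY (d : EvenRegionDataH) : IPoly2 := kernelPDLI d.S (d.cQ 1) (-1) (signedChooseI d.S d.sεI) d.ccQ d.l
/-- [folklore] -/
def QZ3 (d : EvenRegionDataH) : IPoly2 := kernelPDLI d.S (d.cQ 3) (-1) (signedChooseI d.S d.sbI) d.ccQ d.l
/-- [folklore] -/
def QZ4 (d : EvenRegionDataH) : IPoly2 := kernelPDLI d.S (d.cQ 4) 1 (signedChooseI d.S d.sbI) d.ccQ d.l
/-- rows from the tables -/
def PX (d : EvenRegionDataH) (j : ℕ) : IPoly := qRowOfTableI d.QX d.N j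
/-- [folklore] -/
def PY (d : EvenRegionDataH) (j : ℕ) : IPoly := qRowOfTableI d.QY d.N j
/-- [folklore] -/
def PZ (d : EvenRegionDataH) (j : ℕ) : IPoly := addI (qRowOfTableI d.QZ3 d.N j) (qRowOfTableI d.QZ4 d.N j)

/-- **Hybrid even check, rows from the `(P,D)` tables**, discriminant rows by the product-free enclosure test
`rowPosDE` (tail as in `checkL`). [folklore] -/
def checkP (d : EvenRegionDataH) : Bool :=
  decide (0 < d.S) && decide (0 < d.E0) && decide (d.E1 ≤ (d.J1 : ℚ) + 1) && momLenOK d.N d.R &&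
  kernelSizeOK d.S (d.cQ 0) (-1) d.sσI d.ccQ d.l d.N && kernelSizeOK d.S (d.cQ 1) (-1) d.sεI d.ccQ d.l d.N &&
  kernelSizeOK d.S (d.cQ 3) (-1) d.sbI d.ccQ d.l d.N && kernelSizeOK d.S (d.cQ 4) 1 d.sbI d.ccQ d.l d.N &&
  decide (1 ≤ d.prmX.θhi) && decide (1 ≤ d.prmY.θhi) && decide (1 ≤ d.prmD.θhi) &&
  halfStripPos2 d.S d.TX (d.E1 - d.ccQ) d.prmX && halfStripPos2 d.S d.TY (d.E1 - d.ccQ) d.prmY &&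
  halfStripPosD d.S d.TX d.TY d.TZ (d.E1 - d.ccQ) d.prmD &&
  (List.range (d.J1 + 1)).all fun j =>
    rowPosP d.S d.dPj (d.PX j) d.E0 d.E1 d.ccQ j && rowPosP d.S d.dPj (d.PY j) d.E0 d.E1 d.ccQ j &&
      rowPosDE d.S d.dPj (d.PX j) (d.PY j) (d.PZ j) d.E0 d.E1 d.ccQ j

end EvenRegionDataH

/-- **The even region from the table-row hybrid check** (statement of `taylorEvenRegion_of_evenRegionCheckH`).
[folklore] -/
theorem taylorEvenRegion_of_evenRegionCheckHP (d : EvenRegionDataH) (hl : d.l.Nodup) (Q : Set (ℝ × ℝ))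
    (hQ : ∀ p ∈ Q, MI.mem d.S p.1 d.sσI ∧ MI.mem d.S p.2 d.sεI ∧ MI.mem d.S ((p.1 + p.2) / 2) d.sbI)
    (h : d.checkP = true) :
    TaylorEvenRegion (taylorCrossing (1 / 2) (1 / 2) d.l.toFinset fun i ab => (d.cQ i ab : ℝ)) Q ((d.E0 : ℚ) : ℝ) := by
  simp only [EvenRegionDataH.checkP, Bool.and_eq_true, decide_eq_true_eq] at h
  obtain ⟨⟨⟨⟨⟨⟨⟨⟨⟨⟨⟨⟨⟨⟨hS, hE0⟩, hJ1⟩, hR⟩, hN0⟩, hN1⟩, hN3⟩, hN4⟩, hθX⟩, hθY⟩, hθD⟩, hX⟩, hY⟩, hD⟩, hrows⟩ := h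
  refine taylorEvenRegion_half_of_qRegion _ _ Q _ fun p hp E j hE hj => ?_
  obtain ⟨hsσ, hsε, hsb⟩ := hQ p hp
  have hEpos : 0 < E := lt_of_lt_of_le (by exact_mod_cast hE0) hE
  by_cases hE1 : ((d.E1 : ℚ) : ℝ) ≤ E
  · -- tail: (E, θ) tables from E₁ on (identical to `checkL`)
    have hθ := div_mem_unit hEpos hj
    have hP : ((d.E1 - d.ccQ : ℚ) : ℝ) ≤ E - d.ccQ := by push_cast; linarith
    have eX := qSum_eq_eval2_momTable hS (d.cQ 0) (-1) hsσ d.ccQ hl hN0 hR hEpos j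
    have eY := qSum_eq_eval2_momTable hS (d.cQ 1) (-1) hsε d.ccQ hl hN1 hR hEpos j
    have eZ3 := qSum_eq_eval2_momTable hS (d.cQ 3) (-1) hsb d.ccQ hl hN3 hR hEpos j
    have eZ4 := qSum_eq_eval2_momTable hS (d.cQ 4) 1 hsb d.ccQ hl hN4 hR hEpos j
    have pX := pmem2_momTableI hS (d.cQ 0) (-1) hsσ d.ccQ d.l d.N d.R
    have pY := pmem2_momTableI hS (d.cQ 1) (-1) hsε d.ccQ d.l d.N d.R
    have pZ := pmem2_add2I (pmem2_momTableI hS (d.cQ 3) (-1) hsb d.ccQ d.l d.N d.R)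
      (pmem2_momTableI hS (d.cQ 4) 1 hsb d.ccQ d.l d.N d.R)
    have vX := halfStripPos2_sound hS pX hX hP hθ.1 (hθ.2.trans (by exact_mod_cast hθX))
    have vY := halfStripPos2_sound hS pY hY hP hθ.1 (hθ.2.trans (by exact_mod_cast hθY))
    have vD := halfStripPosD_sound hS pX pY pZ hD hP hθ.1 (hθ.2.trans (by exact_mod_cast hθD))
    rw [eval2_add2] at vD
    simp only [Rat.cast_neg, Rat.cast_one] at eX eY eZ3 eZ4
    have goalD : (qSum (fun ab => (d.cQ 3 ab : ℝ)) d.l.toFinset ((p.1 + p.2) / 2) (-1) E j +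
        qSum (fun ab => (d.cQ 4 ab : ℝ)) d.l.toFinset ((p.1 + p.2) / 2) 1 E j) ^ 2 ≤
        4 * qSum (fun ab => (d.cQ 0 ab : ℝ)) d.l.toFinset p.1 (-1) E j *
          qSum (fun ab => (d.cQ 1 ab : ℝ)) d.l.toFinset p.2 (-1) E j := by
      rw [eX, eY, eZ3, eZ4, sq]; linarith
    exact ⟨by rw [eX]; exact vX.le, by rw [eY]; exact vY.le, goalD⟩
  · -- bounded part: rows from the (P,D) tables at the integer j
    have hElt : E < d.E1 := lt_of_not_ge hE1
    have hjJ : j < d.J1 + 1 := by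
      have h1 : (j : ℝ) < (d.J1 : ℝ) + 1 := by
        have : ((d.E1 : ℚ) : ℝ) ≤ (d.J1 : ℝ) + 1 := by exact_mod_cast hJ1
        linarith
      exact_mod_cast h1
    have hrow := List.all_eq_true.mp hrows j (List.mem_range.mpr hjJ)
    simp only [Bool.and_eq_true] at hrow
    obtain ⟨⟨rX, rY⟩, rD⟩ := hrow
    have pX := pmem_qRowOfTableI (pmem2_kernelPDLI_of_mem hS hsσ (d.cQ 0) (-1) d.ccQ d.l) d.N j
    have pY := pmem_qRowOfTableI (pmem2_kernelPDLI_of_mem hS hsε (d.cQ 1) (-1) d.ccQ d.l) d.N j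
    have pZ := pmem_addI (pmem_qRowOfTableI (pmem2_kernelPDLI_of_mem hS hsb (d.cQ 3) (-1) d.ccQ d.l) d.N j)
      (pmem_qRowOfTableI (pmem2_kernelPDLI_of_mem hS hsb (d.cQ 4) 1 d.ccQ d.l) d.N j)
    have vX := pos_of_rowPosP hS rX pX hE hj hElt.le
    have vY := pos_of_rowPosP hS rY pY hE hj hElt.le
    have vD := disc_of_rowPosDE hS rD pX pY pZ hE hj hElt.le
    rw [evalR_addR] at vD
    have eX := qSum_eq_evalR_qRowOfTable hS (d.cQ 0) (-1) hsσ d.ccQ hl hN0 E j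
    have eY := qSum_eq_evalR_qRowOfTable hS (d.cQ 1) (-1) hsε d.ccQ hl hN1 E j
    have eZ3 := qSum_eq_evalR_qRowOfTable hS (d.cQ 3) (-1) hsb d.ccQ hl hN3 E j
    have eZ4 := qSum_eq_evalR_qRowOfTable hS (d.cQ 4) 1 hsb d.ccQ hl hN4 E j
    simp only [Rat.cast_neg, Rat.cast_one] at eX eY eZ3 eZ4 vX vY vD
    have goalD : (qSum (fun ab => (d.cQ 3 ab : ℝ)) d.l.toFinset ((p.1 + p.2) / 2) (-1) E j +
        qSum (fun ab => (d.cQ 4 ab : ℝ)) d.l.toFinset ((p.1 + p.2) / 2) 1 E j) ^ 2 ≤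
        4 * qSum (fun ab => (d.cQ 0 ab : ℝ)) d.l.toFinset p.1 (-1) E j *
          qSum (fun ab => (d.cQ 1 ab : ℝ)) d.l.toFinset p.2 (-1) E j := by
      rw [eX, eY, eZ3, eZ4, sq]; linarith
    exact ⟨by rw [eX]; exact vX.le, by rw [eY]; exact vY.le, goalD⟩

/-! ### Odd cone -/

namespace OddConeRegionDataH

/-- `(P,D)` tables of the five components. [folklore] -/
def Q3 (d : OddConeRegionDataH) : IPoly2 := kernelPDLI d.S (d.cQ 2) (-1) (signedChooseI d.S d.sbI) d.ccQ d.l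
/-- [folklore] -/
def Q4 (d : OddConeRegionDataH) : IPoly2 := kernelPDLI d.S (d.cQ 3) (-1) (signedChooseI d.S d.sσI) d.ccQ d.l
/-- [folklore] -/
def Q5 (d : OddConeRegionDataH) : IPoly2 := kernelPDLI d.S (d.cQ 4) 1 (signedChooseI d.S d.sσI) d.ccQ d.l
/-- [folklore] -/
def Qψ0 (d : OddConeRegionDataH) : IPoly2 := kernelPDLI d.S d.ψQ 0 (signedChooseI d.S (MI.ofInt d.S 0)) d.ccQ d.lψ
/-- [folklore] -/
def Qψt (d : OddConeRegionDataH) : IPoly2 := kernelPDLI d.S d.ψQ 0 (signedChooseI d.S d.stI) d.ccQ d.lψ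
/-- rows from the tables -/
def P3 (d : OddConeRegionDataH) (j : ℕ) : IPoly := qRowOfTableI d.Q3 d.N j
/-- [folklore] -/
def P4 (d : OddConeRegionDataH) (j : ℕ) : IPoly := qRowOfTableI d.Q4 d.N j
/-- [folklore] -/
def P5 (d : OddConeRegionDataH) (j : ℕ) : IPoly := qRowOfTableI d.Q5 d.N j
/-- [folklore] -/
def Pψ0 (d : OddConeRegionDataH) (j : ℕ) : IPoly := qRowOfTableI d.Qψ0 d.N j
/-- [folklore] -/
def Pψt (d : OddConeRegionDataH) (j : ℕ) : IPoly := qRowOfTableI d.Qψt d.N j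
/-- [folklore] -/
def PM (d : OddConeRegionDataH) (ε : ℤ) (j : ℕ) : IPoly :=
  addI (d.Pψ0 j) (smulQI (-(ε : ℚ)) (smulI d.S d.K1 (d.P3 j)))
/-- [folklore] -/
def PR (d : OddConeRegionDataH) (ε : ℤ) (j : ℕ) : IPoly :=
  addI (addI (d.P4 j) (smulIntI (-1) (d.P5 j)))
    (addI (smulQI (-(ε : ℚ) * (d.κ₀Q / 2)) (smulI d.S d.K2 (d.P3 j))) (smulQI (-(d.κ₀Q⁻¹ / 2)) (smulI d.S d.K3 (d.Pψt j))))

/-- **Hybrid odd-cone check, rows from the `(P,D)` tables** (tail as in `check`). [folklore] -/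
def checkP (d : OddConeRegionDataH) : Bool :=
  decide (0 < d.S) && decide (0 < d.κ₀Q) && decide (0 < d.E0) && decide (d.E1 ≤ (d.J1 : ℚ) + 1) &&
  kernelSizeOK d.S (d.cQ 2) (-1) d.sbI d.ccQ d.l d.N && kernelSizeOK d.S (d.cQ 3) (-1) d.sσI d.ccQ d.l d.N &&
  kernelSizeOK d.S (d.cQ 4) 1 d.sσI d.ccQ d.l d.N && kernelSizeOK d.S d.ψQ 0 (MI.ofInt d.S 0) d.ccQ d.lψ d.N &&
  kernelSizeOK d.S d.ψQ 0 d.stI d.ccQ d.lψ d.N && d.tail.check &&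
  (List.range (d.J1 + 1)).all fun j =>
    rowPosP d.S d.dPj (d.PM 1 j) d.E0 d.E1 d.ccQ j && rowPosP d.S d.dPj (d.PM (-1) j) d.E0 d.E1 d.ccQ j &&
    rowPosP d.S d.dPj (d.PR 1 j) d.E0 d.E1 d.ccQ j && rowPosP d.S d.dPj (d.PR (-1) j) d.E0 d.E1 d.ccQ j

end OddConeRegionDataH

/-- **The odd cone from the table-row hybrid check** (statement of `oddCone_of_oddConeRegionCheckH`). [folklore] -/
theorem oddCone_of_oddConeRegionCheckHP (d : OddConeRegionDataH) (hl : d.l.Nodup) (hlψ : d.lψ.Nodup)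
    (Q : Set (ℝ × ℝ))
    (hQ : ∀ p ∈ Q, MI.mem d.S p.1 d.sσI ∧ MI.mem d.S ((p.1 + p.2) / 2) d.sbI ∧ MI.mem d.S (p.1 - p.2) d.stI ∧
      MI.mem d.S ((1 / 2 : ℝ) ^ (p.1 + p.2)) d.K1 ∧ MI.mem d.S ((1 / 2 : ℝ) ^ (p.2 - p.1)) d.K2 ∧
      MI.mem d.S ((1 / 2 : ℝ) ^ (-(2 * p.2))) d.K3)
    (h : d.checkP = true) :
    ∀ p ∈ Q, ∀ (E : ℝ) (j : ℕ), ((d.E0 : ℚ) : ℝ) ≤ E → (j : ℝ) ≤ E →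
      OddConeAt (taylorCrossing (1 / 2) (1 / 2) d.l.toFinset fun i ab => (d.cQ i ab : ℝ))
        (∑ ab ∈ d.lψ.toFinset, (d.ψQ ab : ℝ) • taylorCoeffAt (1 / 2) (1 / 2) ab) (d.κ₀Q : ℝ) p.1 p.2 E j := by
  simp only [OddConeRegionDataH.checkP, Bool.and_eq_true, decide_eq_true_eq] at h
  obtain ⟨⟨⟨⟨⟨⟨⟨⟨⟨⟨hS, hκ₀⟩, hE0⟩, hJ1⟩, hN3⟩, hN4⟩, hN5⟩, hNψ0⟩, hNψt⟩, htail⟩, hrows⟩ := h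
  intro p hp E j hE hj
  by_cases hE1 : ((d.E1 : ℚ) : ℝ) ≤ E
  · have ht := oddCone_of_oddConeRegionCheckEJ d.tail hl hlψ Q hQ htail p hp E j
    simp only [OddConeRegionDataH.tail, sub_add_cancel] at ht
    exact ht hE1 hj
  · obtain ⟨hsσ, hsb, hst, hK1, hK2, hK3⟩ := hQ p hp
    have hElt : E < d.E1 := lt_of_not_ge hE1
    have hjJ : j < d.J1 + 1 := by
      have h1 : (j : ℝ) < (d.J1 : ℝ) + 1 := by
        have : ((d.E1 : ℚ) : ℝ) ≤ (d.J1 : ℝ) + 1 := by exact_mod_cast hJ1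
        linarith
      exact_mod_cast h1
    have hrow := List.all_eq_true.mp hrows j (List.mem_range.mpr hjJ)
    simp only [Bool.and_eq_true] at hrow
    obtain ⟨⟨⟨rM1, rM2⟩, rR1⟩, rR2⟩ := hrow
    have h0mem : MI.mem d.S (0 : ℝ) (MI.ofInt d.S 0) := by simpa using MI.mem_ofInt d.S 0
    have p3 := pmem_qRowOfTableI (pmem2_kernelPDLI_of_mem hS hsb (d.cQ 2) (-1) d.ccQ d.l) d.N j
    have p4 := pmem_qRowOfTableI (pmem2_kernelPDLI_of_mem hS hsσ (d.cQ 3) (-1) d.ccQ d.l) d.N j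
    have p5 := pmem_qRowOfTableI (pmem2_kernelPDLI_of_mem hS hsσ (d.cQ 4) 1 d.ccQ d.l) d.N j
    have pψ0 := pmem_qRowOfTableI (pmem2_kernelPDLI_of_mem hS h0mem d.ψQ 0 d.ccQ d.lψ) d.N j
    have pψt := pmem_qRowOfTableI (pmem2_kernelPDLI_of_mem hS hst d.ψQ 0 d.ccQ d.lψ) d.N j
    have pM : ∀ ε : ℤ, PMem d.S (addR (qRowOfTable (kernelPDL (fun ab => (d.ψQ ab : ℝ)) d.lψ 0 ((0 : ℚ) : ℝ) (d.ccQ : ℝ)) d.N j)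
        (smulR (-(ε : ℝ)) (smulR ((1 / 2 : ℝ) ^ (p.1 + p.2))
          (qRowOfTable (kernelPDL (fun ab => (d.cQ 2 ab : ℝ)) d.l ((p.1 + p.2) / 2) ((-1 : ℚ) : ℝ) (d.ccQ : ℝ)) d.N j))))
        (d.PM ε j) := fun ε =>
      pmem_addI pψ0 (pmem_smulQI _ (by push_cast; ring) (pmem_smulI hS hK1 p3))
    have pR : ∀ ε : ℤ, PMem d.S
        (addR (addR (qRowOfTable (kernelPDL (fun ab => (d.cQ 3 ab : ℝ)) d.l p.1 ((-1 : ℚ) : ℝ) (d.ccQ : ℝ)) d.N j)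
            (smulR ((-1 : ℤ) : ℝ) (qRowOfTable (kernelPDL (fun ab => (d.cQ 4 ab : ℝ)) d.l p.1 ((1 : ℚ) : ℝ) (d.ccQ : ℝ)) d.N j)))
          (addR (smulR (-(ε : ℝ) * ((d.κ₀Q : ℝ) / 2)) (smulR ((1 / 2 : ℝ) ^ (p.2 - p.1))
              (qRowOfTable (kernelPDL (fun ab => (d.cQ 2 ab : ℝ)) d.l ((p.1 + p.2) / 2) ((-1 : ℚ) : ℝ) (d.ccQ : ℝ)) d.N j)))
            (smulR (-((d.κ₀Q : ℝ)⁻¹ / 2)) (smulR ((1 / 2 : ℝ) ^ (-(2 * p.2)))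
              (qRowOfTable (kernelPDL (fun ab => (d.ψQ ab : ℝ)) d.lψ (p.1 - p.2) ((0 : ℚ) : ℝ) (d.ccQ : ℝ)) d.N j)))))
        (d.PR ε j) := fun ε =>
      pmem_addI (pmem_addI p4 (pmem_smulIntI (-1 : ℤ) p5))
        (pmem_addI (pmem_smulQI _ (by push_cast; ring) (pmem_smulI hS hK2 p3))
          (pmem_smulQI _ (by push_cast; ring) (pmem_smulI hS hK3 pψt)))
    have vM1 := pos_of_rowPosP hS rM1 (pM 1) hE hj hElt.le
    have vM2 := pos_of_rowPosP hS rM2 (pM (-1)) hE hj hElt.le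
    have vR1 := pos_of_rowPosP hS rR1 (pR 1) hE hj hElt.le
    have vR2 := pos_of_rowPosP hS rR2 (pR (-1)) hE hj hElt.le
    simp only [evalR_addR, evalR_smulR, Int.cast_one, Int.cast_neg] at vM1 vM2 vR1 vR2
    have e3 := qSum_eq_evalR_qRowOfTable hS (d.cQ 2) (-1) hsb d.ccQ hl hN3 E j
    have e4 := qSum_eq_evalR_qRowOfTable hS (d.cQ 3) (-1) hsσ d.ccQ hl hN4 E j
    have e5 := qSum_eq_evalR_qRowOfTable hS (d.cQ 4) 1 hsσ d.ccQ hl hN5 E j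
    have eψ0 := qSum_eq_evalR_qRowOfTable hS d.ψQ 0 h0mem d.ccQ hlψ hNψ0 E j
    have eψt := qSum_eq_evalR_qRowOfTable hS d.ψQ 0 hst d.ccQ hlψ hNψt E j
    rw [← e3, ← eψ0] at vM1 vM2
    rw [← e3, ← e4, ← e5, ← eψt] at vR1 vR2
    simp only [Rat.cast_neg, Rat.cast_one, Rat.cast_zero] at vM1 vM2 vR1 vR2
    have hκ₁ : 0 ≤ (1 / 2 : ℝ) ^ (p.1 + p.2) := (Real.rpow_pos_of_pos (by norm_num) _).le
    have hκ₂ : 0 ≤ (1 / 2 : ℝ) ^ (p.2 - p.1) := (Real.rpow_pos_of_pos (by norm_num) _).le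
    have hκ₀R : (0 : ℝ) < (d.κ₀Q : ℝ) := by exact_mod_cast hκ₀
    refine oddConeAt_half_of_qCone _ _ _ _ _ p.1 p.2 E j hj ?_ ?_
    · rw [← abs_of_nonneg hκ₁, ← abs_mul, abs_le]
      constructor <;> linarith
    · have hc : 0 ≤ (d.κ₀Q : ℝ) / 2 * (1 / 2 : ℝ) ^ (p.2 - p.1) := by positivity
      rcases le_total 0 (qSum (fun ab => (d.cQ 2 ab : ℝ)) d.l.toFinset ((p.1 + p.2) / 2) (-1) E j) with h3 | h3
      · rw [abs_of_nonneg h3]; linarith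
      · rw [abs_of_nonpos h3]
        have := mul_nonneg hc (neg_nonneg.mpr h3)
        nlinarith

/-! ### Fixtures: the table-row pipeline runs in the kernel (toys of the tree) -/

/-- [folklore] -/
theorem toyEvenRegionDataHL_checkP : toyEvenRegionDataHL.checkP = true := by
  decide +kernel

/-- [folklore] -/
theorem toyOddConeRegionCertH_data_checkP : toyOddConeRegionCertH.data.checkP = true := by
  decide +kernel

end Summit.CriticalPhenomena.Ising3D
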